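import Summits.Ventures.DiscreteObjects.PP12.OrderThirteenOmEnum
import Summits.Ventures.DiscreteObjects.PP12.OrderThirteenShapeScale
import Summits.Ventures.DiscreteObjects.PP12.OrderThirteenReduction
import Summits.Ventures.DiscreteObjects.PP12.OrderThirteenShapeClass01
import Summits.Ventures.DiscreteObjects.PP12.OrderThirteenShapeClass02
import Summits.Ventures.DiscreteObjects.PP12.OrderThirteenShapeClass03
import Summits.Ventures.DiscreteObjects.PP12.OrderThirteenShapeClass04
import Summits.Ventures.DiscreteObjects.PP12.OrderThirteenShapeClass05
import Summits.Ventures.DiscreteObjects.PP12.OrderThirteenShapeClass06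
import Summits.Ventures.DiscreteObjects.PP12.OrderThirteenShapeClass07
import Summits.Ventures.DiscreteObjects.PP12.OrderThirteenShapeClass08
import Summits.Ventures.DiscreteObjects.PP12.OrderThirteenShapeClass09
import Summits.Ventures.DiscreteObjects.PP12.OrderThirteenShapeClass10
import Summits.Ventures.DiscreteObjects.PP12.OrderThirteenShapeClass11
import Summits.Ventures.DiscreteObjects.PP12.OrderThirteenShapeClass12
import Summits.Ventures.DiscreteObjects.PP12.OrderThirteenShapeClass13
import Summits.Ventures.DiscreteObjects.PP12.OrderThirteenShapeClass14
import Summits.Ventures.DiscreteObjects.PP12.OrderThirteenShapeClass15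
import Summits.Ventures.DiscreteObjects.PP12.OrderThirteenShapeClass16
import Summits.Ventures.DiscreteObjects.PP12.OrderThirteenShapeClass17
import Summits.Ventures.DiscreteObjects.PP12.OrderThirteenShapeClass18
import Summits.Ventures.DiscreteObjects.PP12.OrderThirteenShapeClass19
import Summits.Ventures.DiscreteObjects.PP12.OrderThirteenShapeClass20
import Summits.Ventures.DiscreteObjects.PP12.OrderThirteenShapeClass21
import Summits.Ventures.DiscreteObjects.PP12.OrderThirteenShapeClass22
import Summits.Ventures.DiscreteObjects.PP12.OrderThirteenShapeClass23
import Summits.Ventures.DiscreteObjects.PP12.OrderThirteenShapeClass24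
import Summits.Ventures.DiscreteObjects.PP12.OrderThirteenShapeClass25
import Summits.Ventures.DiscreteObjects.PP12.OrderThirteenShapeClass26
import Summits.Ventures.DiscreteObjects.PP12.OrderThirteenShapeClass27
import Summits.Ventures.DiscreteObjects.PP12.OrderThirteenShapeClass28
import Summits.Ventures.DiscreteObjects.PP12.OrderThirteenShapeClass29
import Summits.Ventures.DiscreteObjects.PP12.OrderThirteenShapeClass30
import Summits.Ventures.DiscreteObjects.PP12.OrderThirteenShapeClass31
import Summits.Ventures.DiscreteObjects.PP12.OrderThirteenShapeClass32
import Summits.Ventures.DiscreteObjects.PP12.OrderThirteenShapeClass33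
import Summits.Ventures.DiscreteObjects.PP12.OrderThirteenShapeClass34
import Summits.Ventures.DiscreteObjects.PP12.OrderThirteenShapeClass35
import Summits.Ventures.DiscreteObjects.PP12.OrderThirteenShapeClass36
import Summits.Ventures.DiscreteObjects.PP12.OrderThirteenShapeClass37
import Summits.Ventures.DiscreteObjects.PP12.OrderThirteenShapeClass38

/-!
# PP(12): NO PROJECTIVE PLANE OF ORDER 12 ADMITS A COLLINEATION OF ORDER 13 (kernel theorem, assembled)
Framing: lottery ticket; floor = certified bounds/negative ranges.

Cell pub-namedobj (venture DiscreteObjects), target (M), designs gen 21 (assembly of designs g16–g21). `Om13.noLiftData13_of_classes` (OrderThirteenOmEnum — designs g22 re-cut of g21's OrderThirteenOmCover: every valid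
`LiftData 11 13` relabels to one of the 38 orbit-matrix classes) + the 38 class refutations (`Shape13.noLiftK`, designs g20 classes 2…38 at the shape level, designs g21
class 1 with the residue leaf test; the multiplier WLOG discharged by `Shape13.noLift_of_reps`) ⇒ **`noLiftData13 : NoLiftData13`** ⇒ (designs g16's
`noOrderThirteen_of_noLiftData13`) **`noOrderThirteenOrder12 : NoOrderThirteenOrder12`**. In print: Janko–van Trung, Geom. Dedicata 11 (1981) / 12 (1982) (not held).
No `sorry`, no new axioms.
-/

set_option maxRecDepth 100000

namespace Summit.Ventures.DiscreteObjects.PP12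

/-- **no lift data with 11 free orbits over `Z₁₃` are valid** (the 38 orbit-matrix classes, each refuted in the kernel) -/
theorem noLiftData13 : NoLiftData13 := by
  refine Om13.noLiftData13_of_classes fun k hk D hV hM => ?_
  interval_cases k
  · -- class 1 = MS[0] (WLOG cell 32, size 3)
    exact Shape13.noLift_of_reps (M := Shape13.M1) (cw := 32) (by decide) (by decide) (fun D hV hM hg => Shape13.noLift1 D hV hM hg) D hV (fun s t => hM s t)
  · -- class 2 = MS[1] (WLOG cell 11, size 3)
    exact Shape13.noLift_of_reps (M := Shape13.M2) (cw := 11) (by decide) (by decide) (fun D hV hM hg => Shape13.noLift2 D hV hM hg) D hV (fun s t => hM s t)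
  · -- class 3 = MS[2] (WLOG cell 69, size 3)
    exact Shape13.noLift_of_reps (M := Shape13.M3) (cw := 69) (by decide) (by decide) (fun D hV hM hg => Shape13.noLift3 D hV hM hg) D hV (fun s t => hM s t)
  · -- class 4 = MS[3] (WLOG cell 57, size 3)
    exact Shape13.noLift_of_reps (M := Shape13.M4) (cw := 57) (by decide) (by decide) (fun D hV hM hg => Shape13.noLift4 D hV hM hg) D hV (fun s t => hM s t)
  · -- class 5 = MS[4] (WLOG cell 89, size 2)
    exact Shape13.noLift_of_reps (M := Shape13.M5) (cw := 89) (by decide) (by decide) (fun D hV hM hg => Shape13.noLift5 D hV hM hg) D hV (fun s t => hM s t)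
  · -- class 6 = MS[5] (WLOG cell 0, size 3)
    exact Shape13.noLift_of_reps (M := Shape13.M6) (cw := 0) (by decide) (by decide) (fun D hV hM hg => Shape13.noLift6 D hV hM hg) D hV (fun s t => hM s t)
  · -- class 7 = MS[6] (WLOG cell 112, size 3)
    exact Shape13.noLift_of_reps (M := Shape13.M7) (cw := 112) (by decide) (by decide) (fun D hV hM hg => Shape13.noLift7 D hV hM hg) D hV (fun s t => hM s t)
  · -- class 8 = MS[7] (WLOG cell 71, size 3)
    exact Shape13.noLift_of_reps (M := Shape13.M8) (cw := 71) (by decide) (by decide) (fun D hV hM hg => Shape13.noLift8 D hV hM hg) D hV (fun s t => hM s t)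
  · -- class 9 = MS[8] (WLOG cell 0, size 3)
    exact Shape13.noLift_of_reps (M := Shape13.M9) (cw := 0) (by decide) (by decide) (fun D hV hM hg => Shape13.noLift9 D hV hM hg) D hV (fun s t => hM s t)
  · -- class 10 = MS[9] (WLOG cell 71, size 3)
    exact Shape13.noLift_of_reps (M := Shape13.M10) (cw := 71) (by decide) (by decide) (fun D hV hM hg => Shape13.noLift10 D hV hM hg) D hV (fun s t => hM s t)
  · -- class 11 = MS[10] (WLOG cell 73, size 3)
    exact Shape13.noLift_of_reps (M := Shape13.M11) (cw := 73) (by decide) (by decide) (fun D hV hM hg => Shape13.noLift11 D hV hM hg) D hV (fun s t => hM s t)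
  · -- class 12 = MS[11] (WLOG cell 112, size 3)
    exact Shape13.noLift_of_reps (M := Shape13.M12) (cw := 112) (by decide) (by decide) (fun D hV hM hg => Shape13.noLift12 D hV hM hg) D hV (fun s t => hM s t)
  · -- class 13 = MS[12] (WLOG cell 23, size 2)
    exact Shape13.noLift_of_reps (M := Shape13.M13) (cw := 23) (by decide) (by decide) (fun D hV hM hg => Shape13.noLift13 D hV hM hg) D hV (fun s t => hM s t)
  · -- class 14 = MS[13] (WLOG cell 69, size 2)
    exact Shape13.noLift_of_reps (M := Shape13.M14) (cw := 69) (by decide) (by decide) (fun D hV hM hg => Shape13.noLift14 D hV hM hg) D hV (fun s t => hM s t)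
  · -- class 15 = MS[14] (WLOG cell 61, size 3)
    exact Shape13.noLift_of_reps (M := Shape13.M15) (cw := 61) (by decide) (by decide) (fun D hV hM hg => Shape13.noLift15 D hV hM hg) D hV (fun s t => hM s t)
  · -- class 16 = MS[15] (WLOG cell 89, size 3)
    exact Shape13.noLift_of_reps (M := Shape13.M16) (cw := 89) (by decide) (by decide) (fun D hV hM hg => Shape13.noLift16 D hV hM hg) D hV (fun s t => hM s t)
  · -- class 17 = MS[16] (WLOG cell 83, size 3)
    exact Shape13.noLift_of_reps (M := Shape13.M17) (cw := 83) (by decide) (by decide) (fun D hV hM hg => Shape13.noLift17 D hV hM hg) D hV (fun s t => hM s t)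
  · -- class 18 = MS[17] (WLOG cell 70, size 3)
    exact Shape13.noLift_of_reps (M := Shape13.M18) (cw := 70) (by decide) (by decide) (fun D hV hM hg => Shape13.noLift18 D hV hM hg) D hV (fun s t => hM s t)
  · -- class 19 = MS[18] (WLOG cell 0, size 3)
    exact Shape13.noLift_of_reps (M := Shape13.M19) (cw := 0) (by decide) (by decide) (fun D hV hM hg => Shape13.noLift19 D hV hM hg) D hV (fun s t => hM s t)
  · -- class 20 = MS[19] (WLOG cell 112, size 3)
    exact Shape13.noLift_of_reps (M := Shape13.M20) (cw := 112) (by decide) (by decide) (fun D hV hM hg => Shape13.noLift20 D hV hM hg) D hV (fun s t => hM s t)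
  · -- class 21 = MS[20] (WLOG cell 54, size 3)
    exact Shape13.noLift_of_reps (M := Shape13.M21) (cw := 54) (by decide) (by decide) (fun D hV hM hg => Shape13.noLift21 D hV hM hg) D hV (fun s t => hM s t)
  · -- class 22 = MS[21] (WLOG cell 0, size 3)
    exact Shape13.noLift_of_reps (M := Shape13.M22) (cw := 0) (by decide) (by decide) (fun D hV hM hg => Shape13.noLift22 D hV hM hg) D hV (fun s t => hM s t)
  · -- class 23 = MS[22] (WLOG cell 102, size 3)
    exact Shape13.noLift_of_reps (M := Shape13.M23) (cw := 102) (by decide) (by decide) (fun D hV hM hg => Shape13.noLift23 D hV hM hg) D hV (fun s t => hM s t)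
  · -- class 24 = MS[23] (WLOG cell 78, size 3)
    exact Shape13.noLift_of_reps (M := Shape13.M24) (cw := 78) (by decide) (by decide) (fun D hV hM hg => Shape13.noLift24 D hV hM hg) D hV (fun s t => hM s t)
  · -- class 25 = MS[24] (WLOG cell 18, size 3)
    exact Shape13.noLift_of_reps (M := Shape13.M25) (cw := 18) (by decide) (by decide) (fun D hV hM hg => Shape13.noLift25 D hV hM hg) D hV (fun s t => hM s t)
  · -- class 26 = MS[25] (WLOG cell 0, size 3)
    exact Shape13.noLift_of_reps (M := Shape13.M26) (cw := 0) (by decide) (by decide) (fun D hV hM hg => Shape13.noLift26 D hV hM hg) D hV (fun s t => hM s t)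
  · -- class 27 = MS[26] (WLOG cell 0, size 3)
    exact Shape13.noLift_of_reps (M := Shape13.M27) (cw := 0) (by decide) (by decide) (fun D hV hM hg => Shape13.noLift27 D hV hM hg) D hV (fun s t => hM s t)
  · -- class 28 = MS[27] (WLOG cell 98, size 3)
    exact Shape13.noLift_of_reps (M := Shape13.M28) (cw := 98) (by decide) (by decide) (fun D hV hM hg => Shape13.noLift28 D hV hM hg) D hV (fun s t => hM s t)
  · -- class 29 = MS[28] (WLOG cell 0, size 3)
    exact Shape13.noLift_of_reps (M := Shape13.M29) (cw := 0) (by decide) (by decide) (fun D hV hM hg => Shape13.noLift29 D hV hM hg) D hV (fun s t => hM s t)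
  · -- class 30 = MS[29] (WLOG cell 0, size 3)
    exact Shape13.noLift_of_reps (M := Shape13.M30) (cw := 0) (by decide) (by decide) (fun D hV hM hg => Shape13.noLift30 D hV hM hg) D hV (fun s t => hM s t)
  · -- class 31 = MS[30] (WLOG cell 78, size 3)
    exact Shape13.noLift_of_reps (M := Shape13.M31) (cw := 78) (by decide) (by decide) (fun D hV hM hg => Shape13.noLift31 D hV hM hg) D hV (fun s t => hM s t)
  · -- class 32 = MS[31] (WLOG cell 0, size 3)
    exact Shape13.noLift_of_reps (M := Shape13.M32) (cw := 0) (by decide) (by decide) (fun D hV hM hg => Shape13.noLift32 D hV hM hg) D hV (fun s t => hM s t)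
  · -- class 33 = MS[32] (WLOG cell 0, size 3)
    exact Shape13.noLift_of_reps (M := Shape13.M33) (cw := 0) (by decide) (by decide) (fun D hV hM hg => Shape13.noLift33 D hV hM hg) D hV (fun s t => hM s t)
  · -- class 34 = MS[33] (WLOG cell 0, size 3)
    exact Shape13.noLift_of_reps (M := Shape13.M34) (cw := 0) (by decide) (by decide) (fun D hV hM hg => Shape13.noLift34 D hV hM hg) D hV (fun s t => hM s t)
  · -- class 35 = MS[34] (WLOG cell 0, size 3)
    exact Shape13.noLift_of_reps (M := Shape13.M35) (cw := 0) (by decide) (by decide) (fun D hV hM hg => Shape13.noLift35 D hV hM hg) D hV (fun s t => hM s t)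
  · -- class 36 = MS[35] (WLOG cell 0, size 3)
    exact Shape13.noLift_of_reps (M := Shape13.M36) (cw := 0) (by decide) (by decide) (fun D hV hM hg => Shape13.noLift36 D hV hM hg) D hV (fun s t => hM s t)
  · -- class 37 = MS[36] (WLOG cell 0, size 3)
    exact Shape13.noLift_of_reps (M := Shape13.M37) (cw := 0) (by decide) (by decide) (fun D hV hM hg => Shape13.noLift37 D hV hM hg) D hV (fun s t => hM s t)
  · -- class 38 = MS[37] (WLOG cell 0, size 2)
    exact Shape13.noLift_of_reps (M := Shape13.M38) (cw := 0) (by decide) (by decide) (fun D hV hM hg => Shape13.noLift38 D hV hM hg) D hV (fun s t => hM s t)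

/-- **no projective plane of order 12 admits a collineation of order 13** -/
theorem noOrderThirteenOrder12 : NoOrderThirteenOrder12 := noOrderThirteen_of_noLiftData13 noLiftData13

end Summit.Ventures.DiscreteObjects.PP12
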